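import Summits.PneNP.PneNP.Theorems.SliceACZero.Negative.SliceIndistVariants

/-!
# Negative lemmas for crux `SliceACZero` (stmt-PneNP-2835), Part VII-C: PARITY against the size-only C⁺

Companion of `SliceIndistVariants.lean` (same vocabulary `wt/prodWeight/prodAvg/sliceAvg`): the variant of
the lines' C⁺ `SliceIndist` that drops the depth bound `C.acDepth ≤ d` (all `acBasis` circuits with
`≤ j^c` gates) is FALSE for every `c ≥ 2` — `not_sliceIndistNoDepth`.  Witness: PARITY as a chain of XORs
over `{∧,∨,¬}` (`exists_parity_circuit`: `≤ 5N+1` gates, depth `≈ 2N`) at `N = 2j` with `j` even: parity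
vanishes identically on the slice (`a_j = 0`) while `E_{μ_{1/2}}[parity] = 1/2`
(`two_mul_card_filter_odd_wt`).  The depth bound is exactly what Boppana's influence bound consumes
(parity has total influence `N`, not `polylog(size)^{d−1}`).  Sorry-free, standard axioms; nothing here
asserts a Theses decl positively.  Source: `Cruxes/SliceACZero/Disproof.lean` Part VII,
refuter-cdisprove-stmt-PneNP-2835-g2-0, 2026-08-16.
-/

noncomputable section

namespace Summit.PneNP.PneNP.Theorems.SliceACZero.Negative

open Literature.Computability.Complexity Filter Finset

/-! ### Variant C is false: PARITY (unbounded depth, linear size) is constant on every slice -/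

/-- The parity of the first `m` coordinates of `x : Fin N → Bool`. [folklore] -/
def prefParity (N m : ℕ) (x : Fin N → Bool) : Bool :=
  decide (Odd #(univ.filter fun i : Fin N => (i : ℕ) < m ∧ x i = true))

/-- No coordinate below `0`: the empty prefix has even parity. [folklore] -/
theorem prefParity_zero (N : ℕ) (x : Fin N → Bool) : prefParity N 0 x = false := by
  unfold prefParity
  have : (univ.filter fun i : Fin N => (i : ℕ) < 0 ∧ x i = true) = ∅ := by
    ext i
    simp
  rw [this, Finset.card_empty]
  decide

/-- One more coordinate: `parity_{m+1} = parity_m ⊕ x_m`. [folklore] -/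
theorem prefParity_succ {N m : ℕ} (hm : m < N) (x : Fin N → Bool) :
    prefParity N (m + 1) x = Bool.xor (prefParity N m x) (x ⟨m, hm⟩) := by
  unfold prefParity
  have hsplit : (univ.filter fun i : Fin N => (i : ℕ) < m + 1 ∧ x i = true) =
      (univ.filter fun i : Fin N => (i : ℕ) < m ∧ x i = true) ∪
        (univ.filter fun i : Fin N => i = ⟨m, hm⟩ ∧ x i = true) := by
    ext i
    simp only [Finset.mem_union, Finset.mem_filter, Finset.mem_univ, true_and, Fin.ext_iff]
    constructor
    · rintro ⟨hi, hx⟩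
      rcases Nat.lt_succ_iff_lt_or_eq.1 hi with h | h
      · exact Or.inl ⟨h, hx⟩
      · exact Or.inr ⟨h, hx⟩
    · rintro (⟨h, hx⟩ | ⟨h, hx⟩)
      · exact ⟨Nat.lt_succ_of_lt h, hx⟩
      · exact ⟨by simp [h], hx⟩
  have hdisj : Disjoint (univ.filter fun i : Fin N => (i : ℕ) < m ∧ x i = true)
      (univ.filter fun i : Fin N => i = ⟨m, hm⟩ ∧ x i = true) := by
    rw [Finset.disjoint_filter]
    rintro i - ⟨hi, -⟩ ⟨rfl, -⟩
    exact lt_irrefl _ hi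
  rw [hsplit, Finset.card_union_of_disjoint hdisj]
  cases hxm : x ⟨m, hm⟩
  · have : (univ.filter fun i : Fin N => i = ⟨m, hm⟩ ∧ x i = true) = ∅ := by
      ext i
      simp only [Finset.mem_filter, Finset.mem_univ, true_and, Finset.notMem_empty, iff_false,
        not_and]
      rintro rfl
      simp [hxm]
    rw [this, Finset.card_empty, Nat.add_zero, Bool.xor_false]
  · have : (univ.filter fun i : Fin N => i = ⟨m, hm⟩ ∧ x i = true) = {⟨m, hm⟩} := by
      ext i
      simp only [Finset.mem_filter, Finset.mem_univ, true_and, Finset.mem_singleton]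
      constructor
      · exact fun h => h.1
      · rintro rfl
        exact ⟨rfl, hxm⟩
    rw [this, Finset.card_singleton, Bool.xor_true]
    by_cases hodd : Odd #(univ.filter fun i : Fin N => (i : ℕ) < m ∧ x i = true)
    · have : ¬ Odd (#(univ.filter fun i : Fin N => (i : ℕ) < m ∧ x i = true) + 1) :=
        fun h' => (Nat.odd_add_one.1 h') hodd
      simp [hodd, this]
    · have : Odd (#(univ.filter fun i : Fin N => (i : ℕ) < m ∧ x i = true) + 1) :=
        Nat.odd_add_one.2 hodd
      simp [hodd, this]

/-- The full prefix is the parity of the weight. [folklore] -/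
theorem prefParity_self (N : ℕ) (x : Fin N → Bool) : prefParity N N x = decide (Odd (wt x)) := by
  unfold prefParity wt
  have : (univ.filter fun i : Fin N => (i : ℕ) < N ∧ x i = true) =
      univ.filter fun i : Fin N => x i = true := by
    ext i
    simp
  rw [this]

/-- XOR of two wires as a depth-2, 5-gate `{∧,∨,¬}`-circuit: `(a ∧ ¬b) ∨ (¬a ∧ b)`. [folklore] -/
theorem acReal_xor2 :
    ACReal (fun v : Fin 2 → Bool => Bool.xor (v 0) (v 1)) 2 5 := by
  have ha : ACReal (fun v : Fin 2 → Bool => v 0 && !v 1) (0 + 1) (0 + 1 + 1) :=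
    acReal_and (acReal_input 0) (acReal_notInput 1)
  have hb : ACReal (fun v : Fin 2 → Bool => !v 0 && v 1) (0 + 1) (1 + 0 + 1) :=
    acReal_and (acReal_notInput 0) (acReal_input 1)
  have h := acReal_or ha hb
  refine (h.congr fun v => ?_).mono (by norm_num) (by norm_num)
  cases v 0 <;> cases v 1 <;> rfl

/-- **Parity has linear-size `{∧,∨,¬}`-circuits** (a chain of XORs; depth `2m+1`, `5m+1` gates for
the first `m` coordinates). [folklore] -/
theorem acReal_prefParity (N : ℕ) : ∀ m, m ≤ N → ACReal (prefParity N m) (2 * m + 1) (5 * m + 1) := by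
  intro m
  induction m with
  | zero =>
    intro _
    exact ((acReal_const false).congr fun x => (prefParity_zero N x).symm).mono (by norm_num)
      (by norm_num)
  | succ m ih =>
    intro hm1
    have hm : m < N := hm1
    have hP : ACRealOver acBasis (prefParity N m) (2 * m + 1) (5 * m + 1) :=
      (ih hm.le).toOver subset_rfl
    have hL : ACRealOver acBasis (fun x : Fin N → Bool => x ⟨m, hm⟩) (2 * m + 1) 0 :=
      ((acReal_input (ι := Fin N) ⟨m, hm⟩).mono (Nat.zero_le _) le_rfl).toOver subset_rfl
    have hF : ACRealOver acBasis (fun v : Fin 2 → Bool => Bool.xor (v 0) (v 1)) 2 5 :=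
      acReal_xor2.toOver subset_rfl
    have hcomp := ACRealOver.comp hF
      (f := ![prefParity N m, fun x : Fin N → Bool => x ⟨m, hm⟩])
      (d := 2 * m + 1) (s := ![5 * m + 1, 0])
      (fun j => by
        fin_cases j
        · simpa using hP
        · simpa using hL)
    have hcomp' := (acRealOver_acBasis_iff _ _ _).1 hcomp
    refine (hcomp'.congr fun x => ?_).mono (by omega) ?_
    · simp only [Matrix.cons_val_zero, Matrix.cons_val_one]
      rw [prefParity_succ hm]
    · simp [Fin.sum_univ_two]
      omega

/-- **A parity circuit**: over `acBasis`, `≤ 5N+1` gates (depth unbounded), accepting exactly the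
points of odd weight. [folklore] -/
theorem exists_parity_circuit (N : ℕ) :
    ∃ C : Circuit (Fin N), C.IsOver acBasis ∧ C.size ≤ 5 * N + 1 ∧
      ∀ x, C.eval x = true ↔ Odd (wt x) := by
  obtain ⟨C, hB, -, hs, he⟩ := (acReal_prefParity N N le_rfl).toCircuit
  refine ⟨C, hB, hs, fun x => ?_⟩
  rw [he, prefParity_self, decide_eq_true_iff]

/-- Flipping one coordinate changes the weight by one, hence flips its parity. [folklore] -/
theorem odd_wt_update_not_iff {N : ℕ} (x : Fin N → Bool) (i : Fin N) :
    Odd (wt (Function.update x i (!x i))) ↔ ¬ Odd (wt x) := by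
  unfold wt
  cases hxi : x i
  · -- switching `i` on inserts it
    have : (univ.filter fun k : Fin N => Function.update x i (!false) k = true) =
        insert i (univ.filter fun k : Fin N => x k = true) := by
      ext k
      by_cases hk : k = i
      · subst hk
        simp
      · simp [hk]
    rw [this, Finset.card_insert_of_notMem (by simp [hxi]), Nat.odd_add_one]
  · -- switching `i` off erases it
    have : (univ.filter fun k : Fin N => Function.update x i (!true) k = true) =
        (univ.filter fun k : Fin N => x k = true).erase i := by
      ext k
      by_cases hk : k = i
      · subst hk
        simp
      · simp [hk]
    have hmem : i ∈ (univ.filter fun k : Fin N => x k = true) := by simp [hxi]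
    rw [this]
    have hcard := Finset.card_erase_add_one hmem
    rw [← hcard, Nat.odd_add_one, not_not]

/-- Exactly half of the cube has odd weight (`N ≥ 1`). [folklore] -/
theorem two_mul_card_filter_odd_wt {N : ℕ} (hN : 1 ≤ N) :
    2 * #(univ.filter fun x : Fin N → Bool => Odd (wt x)) = 2 ^ N := by
  set A := univ.filter fun x : Fin N → Bool => Odd (wt x) with hA
  set B := univ.filter fun x : Fin N → Bool => ¬ Odd (wt x) with hB
  have hAB : #A + #B = 2 ^ N := by
    rw [hA, hB, Finset.card_filter_add_card_filter_not, Finset.card_univ, Fintype.card_fun,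
      Fintype.card_bool, Fintype.card_fin]
  let i₀ : Fin N := ⟨0, hN⟩
  let φ : (Fin N → Bool) → (Fin N → Bool) := fun x => Function.update x i₀ (!x i₀)
  have hφφ : ∀ x, φ (φ x) = x := by
    intro x
    simp only [φ, Function.update_self, Bool.not_not, Function.update_idem, Function.update_eq_self]
  have hAeqB : #A = #B := by
    refine Finset.card_nbij' φ φ ?_ ?_ (fun x _ => hφφ x) (fun x _ => hφφ x)
    · intro x hx
      rw [Finset.mem_coe, hA, Finset.mem_filter] at hx
      rw [Finset.mem_coe, hB, Finset.mem_filter]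
      exact ⟨Finset.mem_univ _, fun h => (odd_wt_update_not_iff x i₀).1 h hx.2⟩
    · intro x hx
      rw [Finset.mem_coe, hB, Finset.mem_filter] at hx
      rw [Finset.mem_coe, hA, Finset.mem_filter]
      refine ⟨Finset.mem_univ _, ?_⟩
      by_contra h
      exact hx.2 (by simpa using (odd_wt_update_not_iff x i₀).not.1 h)  -- ¬Odd (wt (φ x)) → Odd (wt x)
  omega

/-- **Variant C of the lines' C⁺ is FALSE** — `SliceIndist` with the depth bound `C.acDepth ≤ d`
dropped, at any size exponent `c ≥ 2` (the displayed statement). Witness: `ι = Fin (2j)` with `j` even, the middle slice, and the parity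
circuit (`≤ 10j+1 ≤ j²` gates, depth `≈ 4j`): parity vanishes identically on the slice (`a_j = 0`)
but `E_{μ_{1/2}}[parity] = 1/2`. So the depth bound in `SliceIndist` is load-bearing: it is exactly
what Boppana's influence bound consumes (parity has total influence `N`, not `polylog(size)`).
[folklore] -/
theorem not_sliceIndistNoDepth {c : ℕ} (hc2 : 2 ≤ c) :
    ¬ (∀ ε : ℝ, 0 < ε → ∃ j₀ : ℕ, ∀ (ι : Type) [Fintype ι] [DecidableEq ι] (j : ℕ),
        j₀ ≤ j → 2 * j ≤ Fintype.card ι →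
          ∀ C : Circuit ι, C.IsOver acBasis → C.size ≤ j ^ c →
            |prodAvg ((j : ℝ) / (Fintype.card ι : ℝ)) C.eval - sliceAvg C.eval j| ≤ ε) := by
  intro h
  obtain ⟨j₀, hj₀⟩ := h (1 / 4) (by norm_num)
  set j : ℕ := 2 * max j₀ 6 with hj
  have hj12 : 12 ≤ j := by omega
  have hjeven : Even j := ⟨max j₀ 6, by omega⟩
  obtain ⟨C, hB, hs, he⟩ := exists_parity_circuit (2 * j)
  have hsize : C.size ≤ j ^ c := by
    refine hs.trans (le_trans ?_ (Nat.pow_le_pow_right (by omega) hc2))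
    rw [pow_two]
    have := Nat.mul_le_mul_right j hj12
    omega
  have key := hj₀ (Fin (2 * j)) j (by omega) (by simp) C hB hsize
  have hslice : sliceAvg C.eval j = 0 := by
    unfold sliceAvg
    rw [Finset.card_eq_zero.2, Nat.cast_zero, zero_div]
    rw [Finset.filter_eq_empty_iff]
    rintro x - ⟨hw, hx⟩
    have hodd : Odd (wt x) := (he x).1 hx
    rw [hw] at hodd
    exact (Nat.not_even_iff_odd.2 hodd) hjeven
  have hq : (j : ℝ) / (Fintype.card (Fin (2 * j)) : ℝ) = 1 / 2 := by
    rw [Fintype.card_fin]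
    have hj0 : (0 : ℝ) < j := by exact_mod_cast (show 0 < j by omega)
    push_cast
    field_simp
  have hprod : prodAvg ((j : ℝ) / (Fintype.card (Fin (2 * j)) : ℝ)) C.eval = 1 / 2 := by
    rw [hq]
    unfold prodAvg
    have hfilter : (univ.filter fun x : Fin (2 * j) → Bool => C.eval x = true) =
        univ.filter fun x : Fin (2 * j) → Bool => Odd (wt x) := by
      ext x
      simp [he]
    have hterm : ∀ x ∈ (univ.filter fun x : Fin (2 * j) → Bool => Odd (wt x)),
        prodWeight (1 / 2 : ℝ) x = (1 / 2 : ℝ) ^ (2 * j) := by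
      intro x _
      unfold prodWeight
      rw [show (1 : ℝ) - 1 / 2 = 1 / 2 by norm_num, ← pow_add, Fintype.card_fin,
        Nat.add_sub_cancel' ((wt_le_card x).trans (by rw [Fintype.card_fin]))]
    rw [hfilter, Finset.sum_congr rfl hterm, Finset.sum_const, nsmul_eq_mul]
    have hcount := two_mul_card_filter_odd_wt (N := 2 * j) (by omega)
    have hcount' : (2 : ℝ) * (#(univ.filter fun x : Fin (2 * j) → Bool => Odd (wt x)) : ℝ) =
        (2 : ℝ) ^ (2 * j) := by
      exact_mod_cast hcount
    have h2 : (0 : ℝ) < (2 : ℝ) ^ (2 * j) := by positivity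
    rw [one_div_pow, one_div, ← div_eq_mul_inv, div_eq_iff h2.ne', one_div,
      inv_mul_eq_div, eq_div_iff (by norm_num : (2 : ℝ) ≠ 0)]
    linarith
  rw [hslice, hprod, sub_zero] at key
  norm_num [abs_of_pos] at key

end Summit.PneNP.PneNP.Theorems.SliceACZero.Negative

end
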